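import Literature.NumberTheory.GaloisCohomology.PoitouTateRestrictedRamification
import Mathlib.Algebra.Homology.DerivedCategory.Ext.ExactSequences
import Mathlib.Algebra.Homology.DerivedCategory.Ext.ExtClass
import HarnessLib

/-!
# `Ψ(E) = Ш²_S` on Milne's `Ext` road from ONE local datum in degree 2: the hypotheses `hΨsha` / `hΨsurj` of the
# `S`-restricted `Ш`-pairing as corollaries of Milne ADT I Lemma 4.13 / Harari Prop. 17.25 at `r = 2` (consumable form)

Topic `NumberTheory/GaloisCohomology`; namespace `Literature.NumberTheory.GaloisCohomology.RestrictedExt`.  Theorems only; no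
definition, no named fact, no instance, no `sorry`.  Lane «PT-Ш-S-TC» of crux `stmt-BirchSwinnertonDyer-19032` (cell bsd-eis,
seat bsd-line-x1-p1-w7 gen 12): the two remaining `Ext`-road inputs `hΨsha` ("`Ψ x ∈ Ш²_S`") and `hΨsurj` ("every class of `Ш²_S`
is a `Ψ x`") of -w2 g11's `ShaExtRoad.pairing_perfect` (there `Ψ x = obstruction x = cmp (x ∘ [T])`), reduced to a displayed
LOCAL datum.

THE MATHEMATICS (Milne, ADT I, proof of Thm. 4.10 (a), p. 58; Harari §17.5).  Apply `Ext_{G_S}(A, ·)` to the class-formation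
sequence `T : 0 → Ē_S →f Ī_S →g C̄_S → 0`: `Ext¹(A, C̄_S) →∂ Ext²(A, Ē_S) →f_* Ext²(A, Ī_S)` is exact (Mathlib
`Ext.covariant_sequence_exact₁`, and `[T] ∘ [f] = 0`).  With the comparison `cmp : Ext²(A, Ē_S) → H²(G_S, M^{N_S})` (bsd-eis -w7
g12, `RestrictedRamificationExtComparison*`: bijective) and a map `Λ : Ext²(A, Ī_S) → ∏_{v ∈ S} H²(K_v, M)` which (Λ1)
INTERTWINES `f_*` with the localisations (`Λ (y ∘ [f]) v = loc_v (cmp y)`) and (Λ2) is INJECTIVE — Milne's identification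
`Ext²_{G_S}(·, I_S) = ⊕_{v∈S} H²(K_v, ·)` (Lemma 4.13; Harari Prop. 17.25 / 17.26) in the form the argument consumes —
one gets: (`hΨsha`) `loc_v (cmp (x ∘ [T])) = Λ (x ∘ [T] ∘ [f]) v = 0` at `v ∈ S`, and at the archimedean places by the
standing hypothesis `harch` (`K` totally complex: `H²(Γ_{K_w}, ·) = 0`); (`hΨsurj`) for `c ∈ Ш²_S`, `c = cmp y` (`cmp` onto),
`Λ (y ∘ [f]) = (loc_v c)_v = 0`, hence `y ∘ [f] = 0` (Λ2), hence `y = x ∘ [T]` (exactness).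

* `comp_extClass_comp_mk₀_f` — `(x ∘ [T]) ∘ [f] = 0`.
* **`cmp_comp_extClass_mem_shaRestricted`** (`hΨsha` from (Λ1) + `harch`).
* **`exists_cmp_comp_extClass_eq_of_mem_shaRestricted`** (`hΨsurj` from (Λ1) + (Λ2) + `cmp` surjective).

Everything is over an abstract abelian category `𝒞` with `Ext` (as in `ShaExtRoad`); `Λ` is displayed as `S`-indexed additive
maps.  Not here: the construction of `Λ` with (Λ1)/(Λ2) (Shapiro over the layers `J_{F,S}` plus the passage from the
decomposition groups of `K_S` to the full local Galois groups in degree 2) — that is the lane's remaining local input.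
HONEST FRAMING: a reduction with displayed hypotheses; no case of Poitou–Tate duality or BSD is proved here.  AI
formalisation, established only by the kernel check.

## References
* J. S. Milne, *Arithmetic Duality Theorems*, 2nd ed. (2006), I Lemma 4.13, I Thm. 4.10 (a) and its proof (p. 58). [MilneADT2006]
* D. Harari, *Galois Cohomology and Class Field Theory*, Universitext (2020), Prop. 17.25, Prop. 17.26, §17.5. [Harari2020]
-/

noncomputable section

open Function NumberField IsDedekindDomain CategoryTheory CategoryTheory.Abelian
open scoped NumberField

universe w v u

namespace Literature.NumberTheory.GaloisCohomology

open Literature.NumberTheory.GaloisRepresentations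
open Literature.NumberTheory.GaloisRepresentations.DiscreteGaloisModule (restrictedCohomology restrictedLocalization
  shaRestricted)

namespace RestrictedExt

variable {K : Type} [Field K] [NumberField K] {M : Type} [AddCommGroup M] [TopologicalSpace M] [DiscreteTopology M]
  (ρ : DiscreteGaloisModule K M) (S : Set (HeightOneSpectrum (𝓞 K)))
  {𝒞 : Type u} [Category.{v} 𝒞] [Abelian 𝒞] [HasExt.{w} 𝒞]
  {T : ShortComplex 𝒞} (hT : T.ShortExact) (A : 𝒞)
  (cmp : Ext A T.X₁ 2 →+ restrictedCohomology ρ S 2)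
  (Λ : ∀ v : HeightOneSpectrum (𝓞 K), v ∈ S → (Ext A T.X₂ 2 →+ galoisCohomology (ρ.toLocal (Sum.inr v)) 2))

omit [NumberField K] in
/-- `(x ∘ [T]) ∘ [f] = x ∘ ([T] ∘ [f]) = 0`: the image of the connecting map dies in `Ext²(A, Ī_S)`.
[cite: Harari2020, §17.5][cite: MilneADT2006, I Thm. 4.10 (a) (proof, p. 58)] -/
theorem comp_extClass_comp_mk₀_f (x : Ext A T.X₃ 1) :
    (x.comp hT.extClass (rfl : 1 + 1 = 2)).comp (Ext.mk₀ T.f) (add_zero 2) = 0 := by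
  rw [Ext.comp_assoc_of_third_deg_zero, hT.extClass_comp, Ext.comp_zero]

/-- **`hΨsha` from the local datum**: if `Λ` intertwines `f_* : Ext²(A, Ē_S) → Ext²(A, Ī_S)` with the localisations of `cmp`
at the places of `S` (Λ1) and the archimedean localisations of `H²(G_S, ·)` vanish (`harch`: `K` totally complex), then
`cmp (x ∘ [T]) ∈ Ш²_S` for every `x ∈ Ext¹(A, C̄_S)`. [cite: MilneADT2006, I Thm. 4.10 (a) (proof, p. 58), I Lemma 4.13]
[cite: Harari2020, Prop. 17.25, §17.5] -/
theorem cmp_comp_extClass_mem_shaRestricted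
    (hΛ1 : ∀ (v : HeightOneSpectrum (𝓞 K)) (hv : v ∈ S) (y : Ext A T.X₁ 2),
      Λ v hv (y.comp (Ext.mk₀ T.f) (add_zero 2)) = restrictedLocalization ρ S (Sum.inr v) 2 (cmp y))
    (harch : ∀ (w : InfinitePlace K) (c : restrictedCohomology ρ S 2), restrictedLocalization ρ S (Sum.inl w) 2 c = 0)
    (x : Ext A T.X₃ 1) :
    cmp (x.comp hT.extClass (rfl : 1 + 1 = 2)) ∈ shaRestricted ρ S 2 := by
  rw [DiscreteGaloisModule.mem_shaRestricted_iff]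
  refine ⟨fun w => harch w _, fun v hv => ?_⟩
  rw [← hΛ1 v hv, comp_extClass_comp_mk₀_f hT A x, map_zero]

/-- **`hΨsurj` from the local datum**: if moreover `Λ` is injective on `Ext²(A, Ī_S)` jointly in `v ∈ S` (Λ2) and `cmp` is onto,
every class of `Ш²_S` is `cmp (x ∘ [T])` for some `x ∈ Ext¹(A, C̄_S)` (exactness of `Ext¹(A, C̄_S) → Ext²(A, Ē_S) → Ext²(A, Ī_S)`).
[cite: MilneADT2006, I Thm. 4.10 (a) (proof, p. 58), I Lemma 4.13][cite: Harari2020, Prop. 17.25, §17.5] -/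
theorem exists_cmp_comp_extClass_eq_of_mem_shaRestricted
    (hΛ1 : ∀ (v : HeightOneSpectrum (𝓞 K)) (hv : v ∈ S) (y : Ext A T.X₁ 2),
      Λ v hv (y.comp (Ext.mk₀ T.f) (add_zero 2)) = restrictedLocalization ρ S (Sum.inr v) 2 (cmp y))
    (hΛ2 : ∀ z : Ext A T.X₂ 2, (∀ (v : HeightOneSpectrum (𝓞 K)) (hv : v ∈ S), Λ v hv z = 0) → z = 0)
    (hcmp : Function.Surjective cmp) (c : restrictedCohomology ρ S 2) (hc : c ∈ shaRestricted ρ S 2) :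
    ∃ x : Ext A T.X₃ 1, cmp (x.comp hT.extClass (rfl : 1 + 1 = 2)) = c := by
  obtain ⟨y, rfl⟩ := hcmp c
  rw [DiscreteGaloisModule.mem_shaRestricted_iff] at hc
  have hy : y.comp (Ext.mk₀ T.f) (add_zero 2) = 0 :=
    hΛ2 _ fun v hv => by rw [hΛ1 v hv, hc.2 v hv]
  obtain ⟨x, hx⟩ := Ext.covariant_sequence_exact₁ (X := A) (hS := hT) y hy (rfl : 1 + 1 = 2)
  exact ⟨x, by rw [hx]⟩

/-- The same with `cmp` an additive EQUIVALENCE (the form delivered by `RestrictedRamificationExtComparison*`).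
[cite: MilneADT2006, I Thm. 4.10 (a) (proof, p. 58)] -/
theorem exists_cmp_comp_extClass_eq_of_mem_shaRestricted' (cmpE : Ext A T.X₁ 2 ≃+ restrictedCohomology ρ S 2)
    (hΛ1 : ∀ (v : HeightOneSpectrum (𝓞 K)) (hv : v ∈ S) (y : Ext A T.X₁ 2),
      Λ v hv (y.comp (Ext.mk₀ T.f) (add_zero 2)) = restrictedLocalization ρ S (Sum.inr v) 2 (cmpE y))
    (hΛ2 : ∀ z : Ext A T.X₂ 2, (∀ (v : HeightOneSpectrum (𝓞 K)) (hv : v ∈ S), Λ v hv z = 0) → z = 0)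
    (c : restrictedCohomology ρ S 2) (hc : c ∈ shaRestricted ρ S 2) :
    ∃ x : Ext A T.X₃ 1, cmpE (x.comp hT.extClass (rfl : 1 + 1 = 2)) = c :=
  exists_cmp_comp_extClass_eq_of_mem_shaRestricted ρ S hT A cmpE.toAddMonoidHom Λ hΛ1 hΛ2 cmpE.surjective c hc

end RestrictedExt

end Literature.NumberTheory.GaloisCohomology

end
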